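import Literature.Analysis.FluidPDE.CompressibleEulerImplosionCentreExpansionWindow2
import Literature.Analysis.FluidPDE.CompressibleEulerImplosionGermUniform
import Literature.Analysis.FluidPDE.CompressibleEulerImplosionUniqueness
import HarnessLib

/-!
# Buckmaster–Cao-Labora–Gómez-Serrano at `γ = 5/3`: the `P₀` germ on the certified disc (shooting window 2)

Companion of `…GermUniform` (the explicit germ `ξ ↦ (W, Z)(ξ) = (e^{−ξ}𝒲(e^ξ), −e^{−ξ}𝒲(−e^ξ))` of the `P₀`
trajectory, controlled there only for `ξ ≤ −16`) and of the certified centre series on the shooting window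
`r ∈ [13890041/12500000, 697/625]` (`…OriginSeriesGrowth`, `…OriginSeriesBall`, `…CentreExpansionWindow2`).
Using the kernel-certified coefficient ranges (signs of `w₂, …, w₁₉`) and majorant, this file extends the
control of the germ to the whole certified disc `e^ξ ≤ 17/50` (`< 25/73`, the certified radius):

* `three_zeta_DZ_neg`, `three_zeta_DW_pos` — `3ζ + 𝒲(ζ) − 2𝒲(−ζ) < 0 < 3ζ + 2𝒲(ζ) − 𝒲(−ζ)` for
  `0 < ζ ≤ 17/50`, i.e. `D_Z < 0 < D_W` along the germ (`germ_signs_window2`): the germ stays off the sonic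
  lines, so the sonic time `T₀` of the `P₀` orbit satisfies `e^{T₀} ≥ 17/50`;
* `germ_hasDerivAt_window2` — the germ solves (1.8) in resolved form for `e^ξ ≤ 17/50`;
* `eqOn_of_field_implicit` — uniqueness variant of `…Uniqueness.eqOn_of_field` in which the second curve is
  only known to solve the IMPLICIT system `D_W W′ = N_W`, `D_Z Z′ = N_Z` (the form in which the pinned orbit of
  the crux `DenseExcursion` is recorded); hence the pinned orbit IS the germ up to `e^ξ = 17/50`.

[cite: BuckmasterCaolaboraGomezserrano2025, Prop. 2.5, Prop. 1.6, §6]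
-/

noncomputable section

open Filter Topology

namespace Literature.Analysis.FluidPDE

namespace BuckmasterCaolaboraGomezserrano2025

namespace OriginSeries

namespace CentreW2

set_option linter.style.longLine false
set_option linter.style.setOption false
set_option maxRecDepth 100000
set_option maxHeartbeats 4000000

/-! ### Kernel side: two majorant sums at `ζ₁ = 17/50` and the signs of `w₂, …, w₁₉` -/

/-- `ζ₁ = 17/50`. [folklore] -/
def z1Q : ℚ := 17 / 50

/-- Head of `Σ_{k ≥ K} B_k ζ₁^k` (orders `K … 60`). [folklore] -/
def headKQ (K : ℕ) : ℚ := sumQ (fun n => hQ (n + K) * z1Q ^ (n + K)) (61 - K)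

/-- Tail constant `Θ/(61³(1 − λζ₁))`. [folklore] -/
def tailGQ : ℚ := thetaQ / 61 ^ 3 / (1 - lamQ * z1Q)

/-- The two budgets: `3Σ_{k≥2} B_kζ₁^k ≤ 3/20`, `3Σ_{k≥20} B_kζ₁^k ≤ 1/20000`. [folklore] -/
theorem signs_budget_ok : 3 * (headKQ 2 + tailGQ) ≤ 3 / 20 ∧ 3 * (headKQ 20 + tailGQ) ≤ 1 / 20000 := by
  constructor <;> decide +kernel

/-- [folklore] -/
theorem z1Q_cast : ((z1Q : ℚ) : ℝ) = 17 / 50 := by unfold z1Q; push_cast; ring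

/-- [folklore] -/
theorem lam_z1_lt_one : (73 / 25 : ℝ) * (17 / 50) < 1 := by norm_num

/-- [folklore] -/
theorem tailGQ_cast : ((tailGQ : ℚ) : ℝ) = (1 / 400000 : ℝ) / 61 ^ 3 / (1 - (73 / 25 : ℝ) * (17 / 50)) := by
  unfold tailGQ; push_cast; rw [thetaQ_cast, lamQ_cast, z1Q_cast]

/-- Lower coefficient bound from the certified ranges: `q ≤ lo_k ⇒ q ≤ w_k`. [cite: BuckmasterCaolaboraGomezserrano2025, App. B] -/
theorem le_w_of_chk {r : ℝ} (hr : r ∈ Set.Icc ((13890041/12500000 : ℚ) : ℝ) ((697/625 : ℚ) : ℝ)) {k : ℕ} (hk : k ≤ 60)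
    (q : ℚ) (hq : decide (q ≤ (bndsW2.getD k (0, 0)).1) = true) : (q : ℝ) ≤ w r 1 k := by
  have h1 := (centre_coeff_boundsW2 hr hk).1
  have h2 : q ≤ (bndsW2.getD k (0, 0)).1 := of_decide_eq_true hq
  exact le_trans (by exact_mod_cast h2) h1

/-- Upper coefficient bound from the certified ranges: `hi_k ≤ q ⇒ w_k ≤ q`. [cite: BuckmasterCaolaboraGomezserrano2025, App. B] -/
theorem w_le_of_chk {r : ℝ} (hr : r ∈ Set.Icc ((13890041/12500000 : ℚ) : ℝ) ((697/625 : ℚ) : ℝ)) {k : ℕ} (hk : k ≤ 60)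
    (q : ℚ) (hq : decide ((bndsW2.getD k (0, 0)).2 ≤ q) = true) : w r 1 k ≤ (q : ℝ) := by
  have h1 := (centre_coeff_boundsW2 hr hk).2
  have h2 : (bndsW2.getD k (0, 0)).2 ≤ q := of_decide_eq_true hq
  exact le_trans h1 (by exact_mod_cast h2)

variable {r : ℝ}

/-! ### Real side: the majorant sums -/

/-- `Σ_{k≥K} B_k ζ₁^k ≤ head + tail` for `K ≤ 60`. [folklore] -/
theorem MK_le (hr : r ∈ Set.Icc ((13890041/12500000 : ℚ) : ℝ) ((697/625 : ℚ) : ℝ)) {K : ℕ} (hK : K ≤ 60) :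
    Summable (fun n : ℕ => Bb (n + K) * (17 / 50 : ℝ) ^ (n + K)) ∧
    ∑' n : ℕ, Bb (n + K) * (17 / 50 : ℝ) ^ (n + K) ≤ ((headKQ K : ℚ) : ℝ) + ((tailGQ : ℚ) : ℝ) := by
  have hgeo : Summable (fun n : ℕ => (73 / 25 * (17 / 50 : ℝ)) ^ n) :=
    summable_geometric_of_lt_one (by norm_num) lam_z1_lt_one
  have hs : Summable (fun n : ℕ => Bb (n + K) * (17 / 50 : ℝ) ^ (n + K)) := by
    refine Summable.of_nonneg_of_le (fun n => mul_nonneg (Bb_nonneg hr _) (by positivity)) (fun n => ?_)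
      ((hgeo.mul_left ((73 / 25 * (17 / 50 : ℝ)) ^ K)))
    calc Bb (n + K) * (17 / 50 : ℝ) ^ (n + K) ≤ (73 / 25 : ℝ) ^ (n + K) * (17 / 50 : ℝ) ^ (n + K) := by
          gcongr; exact Bb_le_pow _
      _ = (73 / 25 * (17 / 50 : ℝ)) ^ K * (73 / 25 * (17 / 50 : ℝ)) ^ n := by rw [← mul_pow, ← pow_add, add_comm]
  refine ⟨hs, ?_⟩
  rw [← hs.sum_add_tsum_nat_add (61 - K)]
  have hhead : ∑ n ∈ Finset.range (61 - K), Bb (n + K) * (17 / 50 : ℝ) ^ (n + K) = ((headKQ K : ℚ) : ℝ) := by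
    unfold headKQ
    rw [sumQ_cast]
    refine Finset.sum_congr rfl fun n hn => ?_
    rw [Finset.mem_range] at hn
    rw [Bb_of_le (by omega)]
    push_cast [z1Q_cast]
    ring
  have htail : ∑' n : ℕ, Bb (n + (61 - K) + K) * (17 / 50 : ℝ) ^ (n + (61 - K) + K) ≤ ((tailGQ : ℚ) : ℝ) := by
    have hT : HasSum (fun n : ℕ => (1 / 400000 : ℝ) / 61 ^ 3 * (73 / 25 * (17 / 50 : ℝ)) ^ n) ((tailGQ : ℚ) : ℝ) := by
      rw [tailGQ_cast, div_eq_mul_inv _ (1 - (73 / 25 : ℝ) * (17 / 50))]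
      exact (hasSum_geometric_of_lt_one (by norm_num) lam_z1_lt_one).mul_left _
    refine hasSum_le (fun n => ?_) ((summable_nat_add_iff (61 - K)).mpr hs).hasSum hT
    have e : n + (61 - K) + K = n + 61 := by omega
    rw [e, Bb_of_lt (by omega)]
    have hn0 : (0 : ℝ) ≤ n := Nat.cast_nonneg n
    have h61 : (61 : ℝ) ^ 3 ≤ (((n + 61 : ℕ) : ℝ)) ^ 3 := by
      apply pow_le_pow_left₀ (by norm_num); push_cast; linarith
    have hgeo' : (73 / 25 * (17 / 50 : ℝ)) ^ (n + 61) ≤ (73 / 25 * (17 / 50 : ℝ)) ^ n :=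
      pow_le_pow_of_le_one (by norm_num) lam_z1_lt_one.le (by omega)
    calc (1 / 400000 : ℝ) * (73 / 25 : ℝ) ^ (n + 61) / (((n + 61 : ℕ) : ℝ)) ^ 3 * (17 / 50 : ℝ) ^ (n + 61)
        = (1 / 400000 : ℝ) * ((73 / 25 * (17 / 50 : ℝ)) ^ (n + 61)) / (((n + 61 : ℕ) : ℝ)) ^ 3 := by
          rw [mul_pow]; ring
      _ ≤ (1 / 400000 : ℝ) * ((73 / 25 * (17 / 50 : ℝ)) ^ n) / 61 ^ 3 := by
          gcongr
      _ = _ := by ring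
  rw [hhead]
  linarith

/-! ### The signs of `D_Z`, `D_W` along the germ -/

/-- `|w_n| ≤ 1·λⁿ` (the input form of `…OriginSeriesBall`). [folklore] -/
theorem abs_w_le_one_mul_pow (hr : r ∈ Set.Icc ((13890041/12500000 : ℚ) : ℝ) ((697/625 : ℚ) : ℝ)) :
    ∀ n, |w r 1 n| ≤ 1 * (73 / 25 : ℝ) ^ n := fun n => by rw [one_mul]; exact abs_w_le_pow hr n

/-- A term of the `D_Z`-series for `2 ≤ k ≤ 19` is `≤ 0`, even case. [cite: BuckmasterCaolaboraGomezserrano2025, App. B] -/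
theorem termZ_nonpos_even (hr : r ∈ Set.Icc ((13890041/12500000 : ℚ) : ℝ) ((697/625 : ℚ) : ℝ)) {k : ℕ} (hk : k ≤ 60)
    (hpar : k % 2 = 0) (hq : decide ((0 : ℚ) ≤ (bndsW2.getD k (0, 0)).1) = true) {ζ : ℝ} (hζ : 0 ≤ ζ) :
    w r 1 k * (ζ ^ k - 2 * (-ζ) ^ k) ≤ 0 := by
  have hw : 0 ≤ w r 1 k := by have := le_w_of_chk hr hk 0 hq; simpa using this
  have he : Even k := Nat.even_iff.mpr hpar
  rw [he.neg_pow]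
  have : ζ ^ k - 2 * ζ ^ k = -(ζ ^ k) := by ring
  rw [this]
  have : 0 ≤ ζ ^ k := by positivity
  nlinarith

/-- A term of the `D_Z`-series for `2 ≤ k ≤ 19` is `≤ 0`, odd case. [cite: BuckmasterCaolaboraGomezserrano2025, App. B] -/
theorem termZ_nonpos_odd (hr : r ∈ Set.Icc ((13890041/12500000 : ℚ) : ℝ) ((697/625 : ℚ) : ℝ)) {k : ℕ} (hk : k ≤ 60)
    (hpar : k % 2 = 1) (hq : decide ((bndsW2.getD k (0, 0)).2 ≤ (0 : ℚ)) = true) {ζ : ℝ} (hζ : 0 ≤ ζ) :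
    w r 1 k * (ζ ^ k - 2 * (-ζ) ^ k) ≤ 0 := by
  have hw : w r 1 k ≤ 0 := by have := w_le_of_chk hr hk 0 hq; simpa using this
  have ho : Odd k := Nat.odd_iff.mpr hpar
  rw [ho.neg_pow]
  have : ζ ^ k - 2 * -ζ ^ k = 3 * ζ ^ k := by ring
  rw [this]
  have : 0 ≤ ζ ^ k := by positivity
  nlinarith

/-- The head of the `D_Z`-series: `Σ_{2 ≤ k < 20} w_k(ζ^k − 2(−ζ)^k) ≤ 0` (certified signs of `w₂, …, w₁₉`).
[cite: BuckmasterCaolaboraGomezserrano2025, App. B] -/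
theorem headZ_nonpos (hr : r ∈ Set.Icc ((13890041/12500000 : ℚ) : ℝ) ((697/625 : ℚ) : ℝ)) {ζ : ℝ} (hζ : 0 ≤ ζ) :
    ∑ k ∈ Finset.Ico 2 20, w r 1 k * (ζ ^ k - 2 * (-ζ) ^ k) ≤ 0 := by
  refine Finset.sum_nonpos fun k hk => ?_
  rw [Finset.mem_Ico] at hk
  obtain ⟨hk2, hk20⟩ := hk
  interval_cases k
  · exact termZ_nonpos_even hr (by norm_num) (by norm_num) (by decide +kernel) hζ
  · exact termZ_nonpos_odd hr (by norm_num) (by norm_num) (by decide +kernel) hζ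
  · exact termZ_nonpos_even hr (by norm_num) (by norm_num) (by decide +kernel) hζ
  · exact termZ_nonpos_odd hr (by norm_num) (by norm_num) (by decide +kernel) hζ
  · exact termZ_nonpos_even hr (by norm_num) (by norm_num) (by decide +kernel) hζ
  · exact termZ_nonpos_odd hr (by norm_num) (by norm_num) (by decide +kernel) hζ
  · exact termZ_nonpos_even hr (by norm_num) (by norm_num) (by decide +kernel) hζ
  · exact termZ_nonpos_odd hr (by norm_num) (by norm_num) (by decide +kernel) hζ
  · exact termZ_nonpos_even hr (by norm_num) (by norm_num) (by decide +kernel) hζ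
  · exact termZ_nonpos_odd hr (by norm_num) (by norm_num) (by decide +kernel) hζ
  · exact termZ_nonpos_even hr (by norm_num) (by norm_num) (by decide +kernel) hζ
  · exact termZ_nonpos_odd hr (by norm_num) (by norm_num) (by decide +kernel) hζ
  · exact termZ_nonpos_even hr (by norm_num) (by norm_num) (by decide +kernel) hζ
  · exact termZ_nonpos_odd hr (by norm_num) (by norm_num) (by decide +kernel) hζ
  · exact termZ_nonpos_even hr (by norm_num) (by norm_num) (by decide +kernel) hζ
  · exact termZ_nonpos_odd hr (by norm_num) (by norm_num) (by decide +kernel) hζ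
  · exact termZ_nonpos_even hr (by norm_num) (by norm_num) (by decide +kernel) hζ
  · exact termZ_nonpos_odd hr (by norm_num) (by norm_num) (by decide +kernel) hζ

/-- Tail estimate: `|Σ_{k≥K} w_k u_k| ≤ 3·Σ_{k≥K} B_k ζ₁^k` when `|u_k| ≤ 3ζ^k`, `0 ≤ ζ ≤ ζ₁`. [folklore] -/
theorem abs_tail_le (hr : r ∈ Set.Icc ((13890041/12500000 : ℚ) : ℝ) ((697/625 : ℚ) : ℝ)) {u : ℕ → ℝ} {s : ℝ} {K : ℕ}
    (hK : K ≤ 60) {ζ : ℝ} (hζ0 : 0 ≤ ζ) (hζ1 : ζ ≤ 17 / 50) (hu : ∀ k, |u k| ≤ 3 * ζ ^ k)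
    (hs : HasSum (fun n => w r 1 (n + K) * u (n + K)) s) :
    |s| ≤ 3 * (((headKQ K : ℚ) : ℝ) + ((tailGQ : ℚ) : ℝ)) := by
  obtain ⟨hsum, hle⟩ := MK_le hr hK
  have h1 : |s| ≤ 3 * ∑' n : ℕ, Bb (n + K) * (17 / 50 : ℝ) ^ (n + K) := by
    refine abs_le_of_hasSum_le hs (hsum.hasSum.mul_left 3) fun n => ?_
    rw [abs_mul]
    have hB := abs_w_le_Bb hr (n + K)
    have hB0 := Bb_nonneg hr (n + K)
    calc |w r 1 (n + K)| * |u (n + K)| ≤ Bb (n + K) * (3 * ζ ^ (n + K)) :=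
          mul_le_mul hB (hu _) (abs_nonneg _) hB0
      _ ≤ Bb (n + K) * (3 * (17 / 50 : ℝ) ^ (n + K)) := by gcongr
      _ = 3 * (Bb (n + K) * (17 / 50 : ℝ) ^ (n + K)) := by ring
  nlinarith [hle]

/-- **`D_Z < 0` along the germ on the certified disc**: `3ζ + 𝒲(ζ) − 2𝒲(−ζ) < 0` for `0 < ζ ≤ 17/50`, on the window.
[cite: BuckmasterCaolaboraGomezserrano2025, Prop. 2.5, App. B] -/
theorem three_zeta_DZ_neg (hr : r ∈ Set.Icc ((13890041/12500000 : ℚ) : ℝ) ((697/625 : ℚ) : ℝ)) {ζ : ℝ} (hζ0 : 0 < ζ)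
    (hζ1 : ζ ≤ 17 / 50) : 3 * ζ + profile r 1 ζ - 2 * profile r 1 (-ζ) < 0 := by
  have hμ : (0 : ℝ) < 73 / 25 := by norm_num
  have hKw := abs_w_le_one_mul_pow hr
  have hζa : (73 / 25 : ℝ) * |ζ| < 1 := by rw [abs_of_pos hζ0]; nlinarith
  have hζb : (73 / 25 : ℝ) * |(-ζ)| < 1 := by rwa [abs_neg]
  have hP := hasSum_profile_of_bound hμ hKw hζa
  have hN := hasSum_profile_of_bound hμ hKw hζb
  -- the combined series
  set f : ℕ → ℝ := fun k => w r 1 k * (ζ ^ k - 2 * (-ζ) ^ k) with hf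
  have hS : HasSum f (profile r 1 ζ - 2 * profile r 1 (-ζ)) := by
    have := hP.sub (hN.mul_left 2)
    refine this.congr_fun fun k => ?_
    simp only [hf]
    ring
  -- split after 20 terms
  have h20 : HasSum (fun n => f (n + 20)) (profile r 1 ζ - 2 * profile r 1 (-ζ) - ∑ i ∈ Finset.range 20, f i) :=
    (hasSum_nat_add_iff' 20).mpr hS
  have hhead : ∑ i ∈ Finset.range 20, f i ≤ -1 + 3 * (1 - r) * ζ := by
    rw [← Finset.sum_range_add_sum_Ico _ (show 2 ≤ 20 by norm_num)]
    have h2 : ∑ i ∈ Finset.range 2, f i = -1 + 3 * (1 - r) * ζ := by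
      simp only [hf, Finset.sum_range_succ, Finset.sum_range_zero, w_zero, w_one one_ne_zero]
      ring
    rw [h2]
    have := headZ_nonpos hr hζ0.le
    simp only [hf]
    linarith
  have htail : |profile r 1 ζ - 2 * profile r 1 (-ζ) - ∑ i ∈ Finset.range 20, f i| ≤ 3 * (((headKQ 20 : ℚ) : ℝ) + ((tailGQ : ℚ) : ℝ)) := by
    refine abs_tail_le hr (K := 20) (by norm_num) hζ0.le hζ1 (u := fun k => ζ ^ k - 2 * (-ζ) ^ k) (fun k => ?_) h20
    calc |ζ ^ k - 2 * (-ζ) ^ k| ≤ |ζ ^ k| + |2 * (-ζ) ^ k| := abs_sub _ _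
      _ = 3 * ζ ^ k := by
          rw [abs_mul, abs_pow, abs_pow, abs_neg, abs_of_pos hζ0, abs_of_pos (by norm_num : (0 : ℝ) < 2)]; ring
  have hbud : (((3 * (headKQ 20 + tailGQ) : ℚ)) : ℝ) ≤ (((1 / 20000 : ℚ)) : ℝ) := by exact_mod_cast signs_budget_ok.2
  push_cast at hbud
  have hr1 : ((13890041 / 12500000 : ℚ) : ℝ) ≤ r := hr.1
  have hr2 : r ≤ ((697 / 625 : ℚ) : ℝ) := hr.2
  push_cast at hr1 hr2
  have hlin : 3 * (2 - r) * ζ ≤ 3 * (2 - 13890041 / 12500000) * (17 / 50) :=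
    mul_le_mul (by nlinarith) hζ1 hζ0.le (by norm_num)
  have := (abs_le.mp htail).2
  nlinarith [this, hhead, hlin, hbud]

/-- **`D_W > 0` along the germ on the certified disc**: `0 < 3ζ + 2𝒲(ζ) − 𝒲(−ζ)` for `0 < ζ ≤ 17/50`, on the window.
[cite: BuckmasterCaolaboraGomezserrano2025, Prop. 2.5, App. B] -/
theorem three_zeta_DW_pos (hr : r ∈ Set.Icc ((13890041/12500000 : ℚ) : ℝ) ((697/625 : ℚ) : ℝ)) {ζ : ℝ} (hζ0 : 0 < ζ)
    (hζ1 : ζ ≤ 17 / 50) : 0 < 3 * ζ + 2 * profile r 1 ζ - profile r 1 (-ζ) := by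
  have hμ : (0 : ℝ) < 73 / 25 := by norm_num
  have hKw := abs_w_le_one_mul_pow hr
  have hζa : (73 / 25 : ℝ) * |ζ| < 1 := by rw [abs_of_pos hζ0]; nlinarith
  have hζb : (73 / 25 : ℝ) * |(-ζ)| < 1 := by rwa [abs_neg]
  have hP := hasSum_profile_of_bound hμ hKw hζa
  have hN := hasSum_profile_of_bound hμ hKw hζb
  set f : ℕ → ℝ := fun k => w r 1 k * (2 * ζ ^ k - (-ζ) ^ k) with hf
  have hS : HasSum f (2 * profile r 1 ζ - profile r 1 (-ζ)) := by
    have := (hP.mul_left 2).sub hN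
    refine this.congr_fun fun k => ?_
    simp only [hf]
    ring
  have h2 : HasSum (fun n => f (n + 2)) (2 * profile r 1 ζ - profile r 1 (-ζ) - ∑ i ∈ Finset.range 2, f i) :=
    (hasSum_nat_add_iff' 2).mpr hS
  have hhead : ∑ i ∈ Finset.range 2, f i = 1 + 3 * (1 - r) * ζ := by
    simp only [hf, Finset.sum_range_succ, Finset.sum_range_zero, w_zero, w_one one_ne_zero]
    ring
  rw [hhead] at h2
  have htail : |2 * profile r 1 ζ - profile r 1 (-ζ) - (1 + 3 * (1 - r) * ζ)| ≤ 3 * (((headKQ 2 : ℚ) : ℝ) + ((tailGQ : ℚ) : ℝ)) := by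
    refine abs_tail_le hr (K := 2) (by norm_num) hζ0.le hζ1 (u := fun k => 2 * ζ ^ k - (-ζ) ^ k) (fun k => ?_) h2
    calc |2 * ζ ^ k - (-ζ) ^ k| ≤ |2 * ζ ^ k| + |(-ζ) ^ k| := abs_sub _ _
      _ = 3 * ζ ^ k := by
          rw [abs_mul, abs_pow, abs_pow, abs_neg, abs_of_pos hζ0, abs_of_pos (by norm_num : (0 : ℝ) < 2)]; ring
  have hbud : (((3 * (headKQ 2 + tailGQ) : ℚ)) : ℝ) ≤ (((3 / 20 : ℚ)) : ℝ) := by exact_mod_cast signs_budget_ok.1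
  push_cast at hbud
  have hr1 : ((13890041 / 12500000 : ℚ) : ℝ) ≤ r := hr.1
  have hr2 : r ≤ ((697 / 625 : ℚ) : ℝ) := hr.2
  push_cast at hr1 hr2
  have hlin : 0 ≤ 3 * (2 - r) * ζ := by nlinarith
  have := (abs_le.mp htail).1
  nlinarith [this, hlin, hbud]

end CentreW2

end OriginSeries

namespace Monatomic

open OriginSeries OriginSeries.CentreW2 Germ

set_option linter.style.longLine false

variable {r : ℝ}

/-- **The germ stays off the sonic lines on the certified disc**: `D_W > 0`, `D_Z < 0` at `germ r ξ` for
`e^ξ ≤ 17/50`, `r ∈ [13890041/12500000, 697/625]`. [cite: BuckmasterCaolaboraGomezserrano2025, Prop. 2.5, §6] -/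
theorem germ_signs_window2 (hr : r ∈ Set.Icc ((13890041/12500000 : ℚ) : ℝ) ((697/625 : ℚ) : ℝ)) {ξ : ℝ}
    (hξ : Real.exp ξ ≤ 17 / 50) :
    0 < DW (germ r ξ).1 (germ r ξ).2 ∧ DZ (germ r ξ).1 (germ r ξ).2 < 0 := by
  rw [germ_fst, germ_snd]
  have hζ0 : 0 < Real.exp ξ := Real.exp_pos ξ
  have hE : Real.exp (-ξ) = (Real.exp ξ)⁻¹ := Real.exp_neg ξ
  have hne : Real.exp ξ ≠ 0 := hζ0.ne'
  have h1 := three_zeta_DW_pos hr hζ0 hξ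
  have h2 := three_zeta_DZ_neg hr hζ0 hξ
  rw [hE]
  unfold DW DZ
  constructor
  · have e : 1 + (2 * ((Real.exp ξ)⁻¹ * profile r 1 (Real.exp ξ)) + -(Real.exp ξ)⁻¹ * profile r 1 (-Real.exp ξ)) / 3
        = (3 * Real.exp ξ + 2 * profile r 1 (Real.exp ξ) - profile r 1 (-Real.exp ξ)) / (3 * Real.exp ξ) := by
      field_simp
      ring
    rw [e]
    positivity
  · have e : 1 + ((Real.exp ξ)⁻¹ * profile r 1 (Real.exp ξ) + 2 * (-(Real.exp ξ)⁻¹ * profile r 1 (-Real.exp ξ))) / 3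
        = (3 * Real.exp ξ + profile r 1 (Real.exp ξ) - 2 * profile r 1 (-Real.exp ξ)) / (3 * Real.exp ξ) := by
      field_simp
      ring
    rw [e]
    exact div_neg_of_neg_of_pos h2 (by positivity)

/-- **The germ solves (1.8) in resolved form on the certified disc** (`e^ξ ≤ 17/50`, window 2).
[cite: BuckmasterCaolaboraGomezserrano2025, Prop. 2.5, eqs. (1.8)–(1.10)] -/
theorem germ_hasDerivAt_window2 (hr : r ∈ Set.Icc ((13890041/12500000 : ℚ) : ℝ) ((697/625 : ℚ) : ℝ)) {ξ : ℝ}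
    (hξ : Real.exp ξ ≤ 17 / 50) : HasDerivAt (germ r) (field r (germ r ξ)) ξ := by
  have hμ : (0 : ℝ) < 73 / 25 := by norm_num
  have hKw := abs_w_le_one_mul_pow hr
  have hpos : 0 < Real.exp ξ := Real.exp_pos ξ
  have hζa : (73 / 25 : ℝ) * |Real.exp ξ| < 1 := by rw [abs_of_pos hpos]; nlinarith
  have hζb : (73 / 25 : ℝ) * |(-Real.exp ξ)| < 1 := by rwa [abs_neg]
  have hd₁ := (analyticAt_profile_of_bound hμ hKw hζa).differentiableAt
  have hd₂ := (analyticAt_profile_of_bound hμ hKw hζb).differentiableAt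
  have e1 := profile_eq_of_bound (r := r) one_ne_zero hμ hKw hpos.ne' hζa
  have e2 := profile_eq_of_bound (r := r) one_ne_zero hμ hKw (neg_ne_zero.mpr hpos.ne') hζb
  simp only [neg_neg] at e2
  obtain ⟨hDW, hDZ⟩ := germ_signs_window2 hr hξ
  exact hasDerivAt_WZofProfile hd₁ hd₂ e1 e2 hDW.ne' hDZ.ne

/-- **Uniqueness against an implicit solution** (variant of `eqOn_of_field`): a resolved solution `c₁` of (1.8) on
`(a, b)` staying off the sonic lines and a differentiable pair `(W₂, Z₂)` solving the IMPLICIT system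
`D_W W₂′ = N_W`, `D_Z Z₂′ = N_Z`, which agree at some `t₀ ∈ (a, b)`, agree on `(a, b)`.
[cite: BuckmasterCaolaboraGomezserrano2025, Prop. 1.6] -/
theorem eqOn_of_field_implicit {c₁ : ℝ → ℝ × ℝ} {W₂ Z₂ : ℝ → ℝ} {a b t₀ : ℝ} (ht₀ : t₀ ∈ Set.Ioo a b)
    (h₁ : ∀ t ∈ Set.Ioo a b, HasDerivAt c₁ (field r (c₁ t)) t)
    (hD : ∀ t ∈ Set.Ioo a b, DW (c₁ t).1 (c₁ t).2 ≠ 0 ∧ DZ (c₁ t).1 (c₁ t).2 ≠ 0)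
    (hW₂ : Differentiable ℝ W₂) (hZ₂ : Differentiable ℝ Z₂)
    (h₂ : ∀ t, DW (W₂ t) (Z₂ t) * deriv W₂ t = NW r (W₂ t) (Z₂ t) ∧ DZ (W₂ t) (Z₂ t) * deriv Z₂ t = NZ r (W₂ t) (Z₂ t))
    (heq : c₁ t₀ = (W₂ t₀, Z₂ t₀)) : Set.EqOn c₁ (fun t => (W₂ t, Z₂ t)) (Set.Ioo a b) := by
  set c₂ : ℝ → ℝ × ℝ := fun t => (W₂ t, Z₂ t) with hc₂
  have hc₂cont : Continuous c₂ := hW₂.continuous.prodMk hZ₂.continuous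
  -- where `c₂` is off the sonic lines it solves the resolved system
  have hres : ∀ s, DW (W₂ s) (Z₂ s) ≠ 0 → DZ (W₂ s) (Z₂ s) ≠ 0 → HasDerivAt c₂ (field r (c₂ s)) s := by
    intro s hW hZ
    have hdW : deriv W₂ s = NW r (W₂ s) (Z₂ s) / DW (W₂ s) (Z₂ s) := by
      rw [eq_div_iff hW, mul_comm]; exact (h₂ s).1
    have hdZ : deriv Z₂ s = NZ r (W₂ s) (Z₂ s) / DZ (W₂ s) (Z₂ s) := by
      rw [eq_div_iff hZ, mul_comm]; exact (h₂ s).2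
    have := ((hW₂ s).hasDerivAt.prodMk (hZ₂ s).hasDerivAt)
    rw [hdW, hdZ] at this
    exact this
  -- local resolved form near a point of agreement
  have hloc : ∀ t ∈ Set.Ioo a b, c₁ t = c₂ t → ∀ᶠ s in 𝓝 t, HasDerivAt c₂ (field r (c₂ s)) s := by
    intro t ht hEq
    have hDt : DW (c₂ t).1 (c₂ t).2 ≠ 0 ∧ DZ (c₂ t).1 (c₂ t).2 ≠ 0 := by rw [← hEq]; exact hD t ht
    have hopen : IsOpen {p : ℝ × ℝ | DW p.1 p.2 ≠ 0 ∧ DZ p.1 p.2 ≠ 0} := by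
      have hcW : Continuous fun p : ℝ × ℝ => DW p.1 p.2 := by unfold DW; fun_prop
      have hcZ : Continuous fun p : ℝ × ℝ => DZ p.1 p.2 := by unfold DZ; fun_prop
      exact (isOpen_ne_fun hcW continuous_const).inter (isOpen_ne_fun hcZ continuous_const)
    have hev : ∀ᶠ s in 𝓝 t, c₂ s ∈ {p : ℝ × ℝ | DW p.1 p.2 ≠ 0 ∧ DZ p.1 p.2 ≠ 0} :=
      hc₂cont.continuousAt.preimage_mem_nhds (hopen.mem_nhds hDt)
    exact hev.mono fun s hs => hres s hs.1 hs.2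
  -- adapted from `eqOn_of_field`: the set of times near which the solutions agree
  set u : Set ℝ := {t | t ∈ Set.Ioo a b ∧ c₁ =ᶠ[𝓝 t] c₂} with hu
  have hev : ∀ t ∈ Set.Ioo a b, ∀ᶠ s in 𝓝 t, s ∈ Set.Ioo a b := fun t ht => isOpen_Ioo.mem_nhds ht
  have hd₁ : ∀ t ∈ Set.Ioo a b, ∀ᶠ s in 𝓝 t, HasDerivAt c₁ (field r (c₁ s)) s :=
    fun t ht => (hev t ht).mono fun s hs => h₁ s hs
  have hu_open : IsOpen u := by
    rw [isOpen_iff_mem_nhds]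
    rintro t ⟨ht, hte⟩
    have : ∀ᶠ s in 𝓝 t, c₁ =ᶠ[𝓝 s] c₂ := hte.eventually_nhds
    exact ((hev t ht).and this).mono fun s hs => hs
  have ht₀u : t₀ ∈ u := ⟨ht₀, eventuallyEq_of_field (hd₁ t₀ ht₀) (hloc t₀ ht₀ heq) (hD t₀ ht₀) heq⟩
  have hcl : closure u ∩ Set.Ioo a b ⊆ u := by
    rintro t ⟨htc, ht⟩
    have hc₁ : ContinuousAt c₁ t := (h₁ t ht).continuousAt
    have hc₂t : ContinuousAt c₂ t := hc₂cont.continuousAt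
    have hEq : c₁ t = c₂ t := by
      have hmem : t ∈ closure {s | c₁ s = c₂ s} :=
        closure_mono (fun s hs => (hs.2 : c₁ =ᶠ[𝓝 s] c₂).eq_of_nhds) htc
      by_contra hne
      have hopen : IsOpen {p : (ℝ × ℝ) × (ℝ × ℝ) | p.1 ≠ p.2} := isOpen_ne_fun continuous_fst continuous_snd
      have : ∀ᶠ s in 𝓝 t, c₁ s ≠ c₂ s :=
        (hc₁.prodMk hc₂t).preimage_mem_nhds (hopen.mem_nhds hne)
      obtain ⟨V, hV, hVsub⟩ : ∃ V ∈ 𝓝 t, ∀ s ∈ V, c₁ s ≠ c₂ s := eventually_iff_exists_mem.mp this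
      obtain ⟨s, hsV, hs⟩ := mem_closure_iff_nhds.mp hmem V hV
      exact hVsub s hsV hs
    exact ⟨ht, eventuallyEq_of_field (hd₁ t ht) (hloc t ht hEq) (hD t ht) hEq⟩
  have hsub : Set.Ioo a b ⊆ u :=
    isPreconnected_Ioo.subset_of_closure_inter_subset hu_open ⟨t₀, ht₀, ht₀u⟩ hcl
  intro t ht
  exact ((hsub ht).2 : c₁ =ᶠ[𝓝 t] c₂).eq_of_nhds

/-- **The pinned orbit is the germ on the certified disc.** A `C¹` pair `(W, Z)` solving the implicit system (1.8)
on `ℝ` which coincides with the `P₀` germ on some interval `(0, ε)` of `ζ = e^ξ` (the origin normalisation of the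
crux's pinned orbit) coincides with the germ for all `ξ` with `e^ξ < 17/50`, on the window.
[cite: BuckmasterCaolaboraGomezserrano2025, Prop. 2.5, Prop. 1.6, §6] -/
theorem orbit_eq_germ_window2 (hr : r ∈ Set.Icc ((13890041/12500000 : ℚ) : ℝ) ((697/625 : ℚ) : ℝ))
    {W Z : ℝ → ℝ} (hW : Differentiable ℝ W) (hZ : Differentiable ℝ Z)
    (heq : ∀ ξ, DW (W ξ) (Z ξ) * deriv W ξ = NW r (W ξ) (Z ξ) ∧ DZ (W ξ) (Z ξ) * deriv Z ξ = NZ r (W ξ) (Z ξ))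
    {ε : ℝ} (hε : 0 < ε)
    (horigin : ∀ ζ ∈ Set.Ioo 0 ε, ζ * W (Real.log ζ) = profile r 1 ζ ∧ -ζ * Z (Real.log ζ) = profile r 1 (-ζ)) :
    ∀ ξ, Real.exp ξ < 17 / 50 → (W ξ, Z ξ) = germ r ξ := by
  intro ξ hξ
  -- a common point `t₀` deep in the origin region, and an interval `(t₀ - 1, log (17/50))`
  set ζ₀ : ℝ := min (ε / 2) (Real.exp ξ / 2) with hζ₀
  have hζ₀pos : 0 < ζ₀ := lt_min (by linarith) (by positivity)
  have hζ₀ε : ζ₀ < ε := (min_le_left _ _).trans_lt (by linarith)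
  set t₀ : ℝ := Real.log ζ₀ with ht₀
  have het₀ : Real.exp t₀ = ζ₀ := by rw [ht₀, Real.exp_log hζ₀pos]
  set b : ℝ := Real.log (17 / 50) with hb
  have hξb : ξ < b := by rw [hb, Real.lt_log_iff_exp_lt (by norm_num)]; exact hξ
  have ht₀ξ : t₀ < ξ := by
    rw [ht₀, Real.log_lt_iff_lt_exp hζ₀pos]
    exact (min_le_right _ _).trans_lt (by linarith [Real.exp_pos ξ])
  have hmem : t₀ ∈ Set.Ioo (t₀ - 1) b := ⟨by linarith, ht₀ξ.trans hξb⟩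
  -- on the interval the germ is a resolved solution off the sonic lines
  have hexp : ∀ t ∈ Set.Ioo (t₀ - 1) b, Real.exp t ≤ 17 / 50 := by
    intro t ht
    have : Real.exp t < Real.exp b := Real.exp_lt_exp.mpr ht.2
    rw [hb, Real.exp_log (by norm_num)] at this
    exact this.le
  have h₁ : ∀ t ∈ Set.Ioo (t₀ - 1) b, HasDerivAt (germ r) (field r (germ r t)) t :=
    fun t ht => germ_hasDerivAt_window2 hr (hexp t ht)
  have hD : ∀ t ∈ Set.Ioo (t₀ - 1) b, DW (germ r t).1 (germ r t).2 ≠ 0 ∧ DZ (germ r t).1 (germ r t).2 ≠ 0 :=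
    fun t ht => ⟨(germ_signs_window2 hr (hexp t ht)).1.ne', (germ_signs_window2 hr (hexp t ht)).2.ne⟩
  -- agreement at `t₀`
  have hagree : germ r t₀ = (W t₀, Z t₀) := by
    obtain ⟨h1, h2⟩ := horigin ζ₀ ⟨hζ₀pos, hζ₀ε⟩
    rw [← ht₀] at h1 h2
    have hE : Real.exp (-t₀) = ζ₀⁻¹ := by rw [Real.exp_neg, het₀]
    refine Prod.ext ?_ ?_
    · rw [germ_fst, het₀, hE, ← h1]; field_simp
    · rw [germ_snd, het₀, hE, ← h2]; field_simp
  have key := eqOn_of_field_implicit hmem h₁ hD hW hZ heq hagree (x := ξ) ⟨by linarith, hξb⟩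
  exact key.symm

end Monatomic

end BuckmasterCaolaboraGomezserrano2025

end Literature.Analysis.FluidPDE
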